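import Summits.HodgeConjecture.HodgeConjecture.Theorems.Ring2AbelianAllAndreWeilSixfoldsMiddleDegree
import Summits.HodgeConjecture.HodgeConjecture.Theorems.Ring2AbelianAllAndreMinimal
import HarnessLib

/-!
# Ring 2 · sub-cell AbelianAll (ALL ABELIAN VARIETIES), André axis, part XXVIII-f — THE SHAPE OF A STRENGTHENED LEMME 6.3.1 THAT
# ABSORBS THE STANDING BRACKET: for a class `P` of abelian varieties admitting CM-anchored compact pencils IN THE HABITAT,
# `HC(A)` for `A ∈ P` follows from `HC_CM` and the idempotent package `CMIdempotentPackage[inv,deg]` — no `CMLerayIdempotentC[]`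

HONEST FRAMING (page 1, verbatim): **research route, not a corollary; conditional on HC_CM plus one named
minimal statement.** Cell line: research route conditional on HC_CM; not a corollary; Q11.4-sentence-2
already refuted in dim ≥ 3. Nothing in this file proves a case of the Hodge conjecture for an abelian variety; `HC_CM` =
`Theses.RankFourFaces.CMAbelianHodge` is an explicit HYPOTHESIS (load-bearing) of the one row below; item `Theses.RankFourFaces.CMToAbelian`
(stmt-16267) OPEN and not closed here. Seat `pub-hodge-ring2-ab-andre-2`, gen 20; brief (ii) "state competing candidates and prove the
implications between them".

## What this file is (and is not)

Parts XXVIII-a…e showed: wherever the CM-pointed pencil used by the André route has, at a CM point `t` and in the degree `2p` of the class,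
its invariant classes algebraic on the fibre (the HABITAT CLAUSE), the standing bracket `CMLerayIdempotentC[]` of the exactness rows of part
XXVII is not needed — the lift (L) gives the idempotent package by itself. André's Lemme 6.3.1 (`andre1996_cmAnchoredPencil`, a named fact)
does NOT assert the clause. THIS FILE TYPES, as a DISPLAY-ONLY bracket parameterised by a class `P` of abelian varieties (no `def`, no node, no
named fact), the SHAPE a strengthened Lemme 6.3.1 would have —
`CMHabitatPencilFor[P]` := for `A ∈ P`, `p`, and a rational `(p,p)` class `c` on `A`: a CM-anchored compact pencil for `(A, p, c)`
(`Andre1996.IsCMAnchoredPencilFor A p c f`, verbatim the data of the fact) having SOME CM point at which the invariant classes of degree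
`2p` are algebraic on the fibre —
and proves the ROW it would feed:
**`hodgeConjectureFor_of_HC_CM_of_cmIdempotentPackageInvDeg_of_habitatPencil`: `CMHabitatPencilFor[P] ∧ HC_CM ∧ CMIdempotentPackage[inv,deg] ⟹
HC(A)` for every `A ∈ P`** (kernel: the package at the habitat CM point is `(N_p f)` (XXVIII-c/d), which gives (L) there (XXVIII-a); `HC_CM` makes
`W|_{X_t}` algebraic; transport out of the fibre (XIX-f) and the chart of Lemme 6.3.1 read `c` — the proof of part IV's `HC_AV_of_HC_CM_and_Bmin`
with (4) replaced by the package), and its unconditional companion `… ⟸ CMHabitatPencilFor[P] ∧ HC_CM ∧ CMFibreAlgebraicLift`.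

IN PRINT (RING2-MAP AA2.162; NOT typed, NOT asserted here): for `P` = "the Hodge group of `A` is semisimple" (every `A` without simple
factors of Albert type IV; the general member of a Weil-type family) André's own pencils are habitat pencils in EVERY degree — on a
CM-pointed family the algebraic monodromy group equals the derived generic Mumford–Tate group (André 1992, Prop. 2 = Carlson–Müller-Stach–
Peters, Prop. 15.3.11), so the fixed part is acted on by `MT(A)` through `MT(A)/MT(A)^{der}`, i.e. by the weight only when `Hg(A)` is
semisimple, hence is of type `(p,p)`. Typing this is a new Literature fact over Mumford–Tate groups of families (a LEAD ruling); the seat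
records the shape and does not mint the fact.

## Honest status

No node is born (two display-only brackets); nothing is minimal; nothing here is fact-free progress on `HC_AV`; `CMHabitatPencilFor[P]` is a
HYPOTHESIS, NOT expected to hold for `P` = all abelian varieties (a pencil with a constant CM factor has transcendental invariants — but the
bracket is `∃`-quantified over pencils, so one bad pencil does not refute it; nothing in the tree refutes `CMHabitatPencilFor[⊤]`, REFEREE-AB
F-ab-118); for which `P` it holds is exactly the question of AA2.162. `HC_CM` load-bearing. 0 sorry.

References: Andre1996Motifs (Lemme 6.3.1, §6.3 a), Remarque 2); Andre1992MTFixedPart = CarlsonMullerStachPeters2017 (Prop. 15.3.11); vanGeemen1994HodgeAV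
(§6.4–6.7); Milne2020HodgeClassesAV (proof of Prop. 1); DeningerMurre1991 (Thm. 3.1).
-/

noncomputable section

set_option linter.dupNamespace false

namespace Summit.HodgeConjecture.HodgeConjecture.Ring2.AbelianAll

open CategoryTheory AlgebraicGeometry
open Literature.AlgebraicGeometry Literature.AlgebraicGeometry.Motives
open Literature.AlgebraicGeometry.HodgeTheory
open Literature.AlgebraicGeometry.Andre1996 (IsCMAnchoredPencilFor)
open Literature.AlgebraicGeometry.Deligne1982 (cmLocus)
open Summit.HodgeConjecture.HodgeConjecture
open Summit.HodgeConjecture.HodgeConjecture.Theses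

section Row

/-- DISPLAY-ONLY bracket (no `def`; REFEREE-AB F-ab-103): `CMIdempotentPackage[inv,deg]` of part XXVIII-c, restated verbatim. -/
local notation3 (prettyPrint := false) "CMIdempotentPackage[inv,deg]" =>
  ∀ ⦃d : ℕ⦄ ⦃𝒳 S : SchemeOver ℂ⦄ (f : 𝒳 ⟶ S), IsCompactAbelianPencil f d → ∀ t ∈ cmLocus f d, ∀ p : ℕ, p ≤ d →
    LinearMap.range (complexBetti.map (fiberι f t) (2 * p)).hom ≤ algebraicClasses (fiberOver f t) p →
    ∃ e : complexBetti 𝒳 (2 * p) →ₗ[ℂ] complexBetti 𝒳 (2 * p),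
      IsAlgebraicCorrespondence (d + 1) (d + 1) 𝒳 𝒳 e ∧
      (∀ w, complexBetti.map (fiberι f t) (2 * p) (e w) = complexBetti.map (fiberι f t) (2 * p) w) ∧
      (∀ w, complexBetti.map (fiberι f t) (2 * p) w = 0 → e w = 0) ∧
      (∀ w, e w ∈ algebraicClasses 𝒳 p)

/-- DISPLAY-ONLY bracket (no `def`; F-ab-103): **`CMHabitatPencilFor[P]` — THE SHAPE OF A STRENGTHENED LEMME 6.3.1 for the class `P`**: for
every `A ∈ P` (smooth projective of dimension `dim A`), every `p` and every rational `(p,p)` class `c` on `A`, a compact pencil `f : 𝒳 ⟶ S` with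
André's data `IsCMAnchoredPencilFor A p c f` (relative dimension `2 dim A`, a CM fibre, a fibre `≅ A₁` with `g : A ⟶ A₁` and a fibrewise-Hodge
global `W` with `g^*(W|) = q·c`, `q ≠ 0`) AND a CM point `t` at which every invariant class of degree `2p` is algebraic on `X_t` (the habitat
clause). A HYPOTHESIS; in print expected for `P` = "semisimple Hodge group" (module docstring); false for `P` = all. -/
local notation3 (prettyPrint := false) "CMHabitatPencilFor[" P "]" =>
  ∀ (A : AbelianVariety ℂ), IsSmoothProjective A.dim A.X → P A →
    ∀ (p : ℕ) (c : complexBetti A.X (2 * p)), IsRationalClass c → IsOfHodgeType A.dim A.X (2 * p) p p c →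
      ∃ (𝒳 S : SchemeOver ℂ) (f : 𝒳 ⟶ S), IsCMAnchoredPencilFor A p c f ∧
        ∃ t ∈ cmLocus f (2 * A.dim),
          LinearMap.range (complexBetti.map (fiberι f t) (2 * p)).hom ≤ algebraicClasses (fiberOver f t) p

variable {P : AbelianVariety ℂ → Prop}

/-- **THE ROW A STRENGTHENED LEMME 6.3.1 WOULD FEED: `CMHabitatPencilFor[P] ∧ HC_CM ∧ CMIdempotentPackage[inv,deg] ⟹ HC(A)` for every
`A ∈ P`** — the André-axis deliverable WITHOUT the standing bracket `CMLerayIdempotentC[]`. Given `A ∈ P`, `p`, `c`: the habitat pencil `f`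
through `A` carries `W` (rational `(p,p)` on every fibre, `g^*(W|_{X_s}) = q·c`) and a CM point `t` with the clause; the package at `(t, 2p)`
is `(N_p f)(t)` (part XXVIII-c), hence (L)_t(p) (part XXVIII-a); `HC_CM` makes `W|_{X_t}` algebraic (`Ring2Transport.mem_algebraicClasses_of_cmChart`,
the ONLY use of `HC_CM`); (L)_t(p) transports algebraicity to `X_s` (part XIX-f `map_fiberι_mem_algebraicClasses_of_comap_le_sup`); the chart
`e₁` and `g^*` (pull-back to an abelian variety, a tree theorem) give `q·c ∈ Nᵖ(A)`. Degrees `p > 2 dim A` are vacuous (`H^{2p}(A) = 0`).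
research route, not a corollary; conditional on HC_CM plus one named minimal statement. [cite: Andre1996Motifs, Lemme 6.3.1 (p. 31) and §6.3 a) (p. 33)]
[cite: Milne2020HodgeClassesAV, proof of Prop. 1 (pp. 7–8)] [cite: DeningerMurre1991, Thm. 3.1] -/
theorem hodgeConjectureFor_of_HC_CM_of_cmIdempotentPackageInvDeg_of_habitatPencil (hP : CMHabitatPencilFor[P])
    (hCM : RankFourFaces.CMAbelianHodge) (hPkg : CMIdempotentPackage[inv,deg]) :
    ∀ (A : AbelianVariety ℂ), IsSmoothProjective A.dim A.X → P A → HodgeConjectureFor A.dim A.X := by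
  intro A hA hPA
  refine (hodgeConjectureFor_iff_of_isSmoothProjective nonempty_hodgeModel_holds hA).2 fun p c hc hpp ↦ ?_
  rcases le_or_gt p (2 * A.dim) with hp | hp
  · obtain ⟨𝒳, S, f, ⟨hf, s, t, W, A₁, A₀, e₁, g, q, hW, hq, hgc, -, -⟩, t', ht', hclause⟩ := hP A hA hPA p c hc hpp
    -- the package at the habitat CM point `t'` is (N_p f)(t'), hence (L)_{t'}(p)
    obtain ⟨e, -, hπ, -, him⟩ := hPkg f hf t' ht' p hp hclause
    have hL := comap_le_sup_of_range_le_map t' (range_le_map_of_exists_lerayIdempotent t' ⟨e, hπ, him⟩)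
    -- `HC_CM` at the CM fibre `X_{t'}`
    obtain ⟨B₀, ⟨eB⟩, hB₀dim, hB₀cm⟩ := ht'
    have h₀ : complexBetti.map (fiberι f t') (2 * p) W ∈ algebraicClasses (fiberOver f t') p :=
      Ring2Transport.mem_algebraicClasses_of_cmChart hCM B₀ eB hB₀dim hB₀cm (hW t').1 (hW t').2
    -- out of the fibre `t'` to the fibre `s`, across the chart `e₁`, back along `g`
    have h₁ := map_fiberι_mem_algebraicClasses_of_comap_le_sup hf hL h₀ s
    have h₂ : complexBetti.map e₁.hom (2 * p) (complexBetti.map (fiberι f s) (2 * p) W) ∈ algebraicClasses A₁.X p :=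
      (mem_algebraicClasses_map_iff_of_iso e₁).2 h₁
    have h₃ : (q : ℂ) • c ∈ algebraicClasses A.X p := by
      rw [← hgc]
      exact map_mem_algebraicClasses_of_abelianVariety hA A₁ g.hom.hom.hom h₂
    exact (Submodule.smul_mem_iff _ (Rat.cast_ne_zero.2 hq)).1 h₃
  · haveI := subsingleton_complexBetti hA (show 2 * A.dim < 2 * p by omega)
    rw [Subsingleton.elim c 0]
    exact Submodule.zero_mem _

/-- **The same row with the LIFT in place of the package: `CMHabitatPencilFor[P] ∧ HC_CM ∧ CMFibreAlgebraicLift ⟹ HC(A)` for `A ∈ P`** (part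
XXVIII-c: (L) ⟹ the package degree by degree in the habitat). For `P` = all this is weaker-or-equal than part IV's
`HC_AV_of_HC_CM_and_cmFibreAlgebraicLift` (which needs no habitat clause) — recorded only to show the two spellings agree on `P`.
[cite: Andre1996Motifs, Lemme 6.3.1 (p. 31) and §6.3 a) (p. 33)] [cite: Milne2020HodgeClassesAV, Prop. 1 (p. 8)] -/
theorem hodgeConjectureFor_of_HC_CM_of_cmFibreAlgebraicLift_of_habitatPencil (hP : CMHabitatPencilFor[P])
    (hCM : RankFourFaces.CMAbelianHodge) (hL : CMFibreAlgebraicLift) :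
    ∀ (A : AbelianVariety ℂ), IsSmoothProjective A.dim A.X → P A → HodgeConjectureFor A.dim A.X :=
  hodgeConjectureFor_of_HC_CM_of_cmIdempotentPackageInvDeg_of_habitatPencil hP hCM (cmIdempotentPackageInvDeg_of_cmFibreAlgebraicLift hL)

/-- **For `P` = all abelian varieties the row returns the cell's `HC_AV`**: `CMHabitatPencilFor[⊤] ∧ HC_CM ∧ CMIdempotentPackage[inv,deg] ⟹ HC_AV`
(the bracket `CMHabitatPencilFor[⊤]` is NOT expected to hold — recorded as the formal end-point of the shape; compare part XXVII-e's row, which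
needs `CMLerayIdempotentC[]` instead). [cite: Andre1996Motifs, Lemme 6.3.1 (p. 31) and Remarque 2 (p. 33)] -/
theorem HC_AV_of_HC_CM_of_cmIdempotentPackageInvDeg_of_habitatPencil_top (hP : CMHabitatPencilFor[fun _ ↦ True])
    (hCM : RankFourFaces.CMAbelianHodge) (hPkg : CMIdempotentPackage[inv,deg]) : PadicSemiregularLift.HodgeAbelianVarieties :=
  Theorems.HodgeAbelianVarieties.Negative.iff_hodgeConjecture_restricted.2 fun A hA ↦
    hodgeConjectureFor_of_HC_CM_of_cmIdempotentPackageInvDeg_of_habitatPencil hP hCM hPkg A hA trivial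

end Row

end Summit.HodgeConjecture.HodgeConjecture.Ring2.AbelianAll

end
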